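import Summits.PneNP.PneNP.Theorems.PstarSAPeeling

/-!
# Sherali–Adams laws for typed `P⋆` fibres, II: the reweighted laws and the one-constraint peel (cell `pnp-ideate`, T21.1a)

FRONTIER range-avoidance ladder, rung F-N3 context — restricted-model bookkeeping for the Sherali–Adams hierarchy
(`PstarSALevel.SAFeasible`); nothing here bears on `P` vs `NP`.

The candidate Sherali–Adams laws for the fibre `I(x) = y` of a typed pure-`P⋆` instance (cell memo
`r20/ROUND-20-SEED.md` §8, after Benabbas–Georgiou–Magen–Tulsiani 2012 §3.2 with balance replaced by the junction-tree
reweighting):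

  `law I y S (x) = ∏_{j ∈ dom S} lp_r(y_j)(x|vars j) · ∏_v ρ_{bias v}(x_v)^{1 − deg_{dom S}(v)}`,

`dom S` = the outputs all of whose variables lie in `S`.  Outside `S` every degree is `0`, so `law I y S` is the
bias-product law there: it is a genuine law on FULL assignments whose `S`-marginal is the reweighted BGMT law — the
shape `PstarSALevel.SAFeasible` asks for.  This file: degrees, the weight `W I y M` of a set `M` of outputs, the laws,
their sign and support (`law_nonneg`, `law_support`), and the two summation steps of the peeling argument:

* `peel_step` — **one-constraint peel**: if `j₀ ∈ M` has a set `F` of `≥ 2` PRIVATE variables (read by no other output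
  of `M`), then summing over the `F`-coordinates does not see `j₀`: `Σ_{β ∈ cylOff F x} W M β = Σ_{β ∈ cylOff F x} W (M \ j₀) β`
  (the peeling identity `sum_cylOff_mu` supplies `∏_{v ∈ vars j₀ \ F} ρ_v`, which is exactly the shift of the
  reweighting exponents of the shared variables);
* `sum_eq_of_cylOff` — lifting a cylinder-wise identity to any set of assignments closed under changing the
  `F`-coordinates (double counting `sum_sum_cylOff`, `card_cylOff = 2^{#F}`), so that peels can be chained inside a
  `T`-cylinder (part III).
-/

set_option linter.dupNamespace false

open Finset Literature.Computability.Complexity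
open Summit.PneNP.PneNP.Theorems.PstarPairwise (rho lp)
open Summit.PneNP.PneNP.Theorems.PstarSALevel (varSet)

namespace Summit.PneNP.PneNP.Theorems.PstarSAPeeling

variable {n m : ℕ}

/-! ## Degrees, the reweighted weight, the laws -/

/-- The number of outputs of `M` reading the variable `v`. -/
def deg (I : LocalMap 4 n m) (M : Finset (Fin m)) (v : Fin n) : ℕ := (M.filter fun j => v ∈ varSet I j).card

/-- The reweighting exponent `1 − deg_M(v)`. -/
def ex (I : LocalMap 4 n m) (M : Finset (Fin m)) (v : Fin n) : ℤ := 1 - (deg I M v : ℤ)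

/-- **The reweighted weight** of a set `M` of outputs at a full assignment: the local factors of `M` times
`∏_v ρ_{bias v}(x_v)^{1 − deg_M(v)}`. -/
noncomputable def W (I : LocalMap 4 n m) (y : Fin m → Bool) (M : Finset (Fin m)) (x : Fin n → Bool) : ℝ :=
  (∏ j ∈ M, mu I y j x) * ∏ v, rho (bias I v) (x v) ^ ex I M v

/-- The outputs DOMINATED by `S`: all their variables lie in `S`. -/
def dom (I : LocalMap 4 n m) (S : Finset (Fin n)) : Finset (Fin m) := univ.filter fun j => varSet I j ⊆ S

/-- **The laws**: `law I y S` is the reweighted weight of the outputs dominated by `S`. -/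
noncomputable def law (I : LocalMap 4 n m) (y : Fin m → Bool) (S : Finset (Fin n)) : (Fin n → Bool) → ℝ :=
  W I y (dom I S)

/-- Membership in `dom`. -/
theorem mem_dom {I : LocalMap 4 n m} {S : Finset (Fin n)} {j : Fin m} : j ∈ dom I S ↔ varSet I j ⊆ S := by
  simp [dom]

/-- `dom` is monotone. -/
theorem dom_mono (I : LocalMap 4 n m) {S T : Finset (Fin n)} (h : T ⊆ S) : dom I T ⊆ dom I S :=
  fun _ hj => mem_dom.2 ((mem_dom.1 hj).trans h)

/-- The weights are nonnegative. -/
theorem W_nonneg (I : LocalMap 4 n m) (y : Fin m → Bool) (M : Finset (Fin m)) (x : Fin n → Bool) : 0 ≤ W I y M x :=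
  mul_nonneg (prod_nonneg fun j _ => mu_nonneg I y j x) (prod_nonneg fun v _ => (zpow_pos (rho_bias_pos I v _) _).le)

/-- The laws are nonnegative. -/
theorem law_nonneg (I : LocalMap 4 n m) (y : Fin m → Bool) (S : Finset (Fin n)) (x : Fin n → Bool) :
    0 ≤ law I y S x :=
  W_nonneg I y _ x

/-- **Support**: an output dominated by `S` takes the value `y j` wherever `law I y S` is nonzero. -/
theorem law_support {I : LocalMap 4 n m} (hI : I.IsPure xorAndPred) (y : Fin m → Bool) {S : Finset (Fin n)} {j : Fin m}
    (hj : varSet I j ⊆ S) {x : Fin n → Bool} (hx : law I y S x ≠ 0) : I.eval x j = y j := by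
  have h := left_ne_zero_of_mul hx
  exact eval_eq_of_mu_ne_zero hI (prod_ne_zero_iff.1 h j (mem_dom.2 hj))

/-! ## Degrees under erasing one output; private variables -/

/-- Erasing `j₀` lowers the degree of exactly the variables of `j₀`, by one. -/
theorem deg_eq_deg_erase_add (I : LocalMap 4 n m) {M : Finset (Fin m)} {j₀ : Fin m} (hj₀ : j₀ ∈ M) (v : Fin n) :
    deg I M v = deg I (M.erase j₀) v + if v ∈ varSet I j₀ then 1 else 0 := by
  unfold deg
  rw [filter_erase]
  by_cases hv : v ∈ varSet I j₀
  · have hmem : j₀ ∈ M.filter (fun j => v ∈ varSet I j) := mem_filter.2 ⟨hj₀, hv⟩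
    rw [if_pos hv, card_erase_of_mem hmem]
    have hpos : 0 < (M.filter fun j => v ∈ varSet I j).card := card_pos.2 ⟨j₀, hmem⟩
    omega
  · have hnot : j₀ ∉ M.filter (fun j => v ∈ varSet I j) := fun h => hv (mem_filter.1 h).2
    rw [if_neg hv, erase_eq_of_notMem hnot, add_zero]

/-- The exponent shift under erasing `j₀`. -/
theorem ex_erase (I : LocalMap 4 n m) {M : Finset (Fin m)} {j₀ : Fin m} (hj₀ : j₀ ∈ M) (v : Fin n) :
    ex I (M.erase j₀) v = ex I M v + if v ∈ varSet I j₀ then 1 else 0 := by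
  unfold ex
  rw [deg_eq_deg_erase_add I hj₀ v]
  split_ifs <;> push_cast <;> ring

/-- The PRIVATE variables of `j₀` in `M`: read by `j₀` and by no other output of `M`. -/
def priv (I : LocalMap 4 n m) (M : Finset (Fin m)) (j₀ : Fin m) : Finset (Fin n) :=
  (varSet I j₀).filter fun v => ∀ j ∈ M, j ≠ j₀ → v ∉ varSet I j

/-- Private variables are variables of `j₀`. -/
theorem priv_subset (I : LocalMap 4 n m) (M : Finset (Fin m)) (j₀ : Fin m) : priv I M j₀ ⊆ varSet I j₀ :=
  filter_subset _ _

/-- A private variable is read by no other output of `M`. -/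
theorem not_mem_of_mem_priv {I : LocalMap 4 n m} {M : Finset (Fin m)} {j₀ j : Fin m} {v : Fin n} (hv : v ∈ priv I M j₀)
    (hj : j ∈ M) (hne : j ≠ j₀) : v ∉ varSet I j :=
  (mem_filter.1 hv).2 j hj hne

/-- After erasing `j₀`, a private variable of `j₀` has degree `0`. -/
theorem deg_erase_of_mem_priv {I : LocalMap 4 n m} {M : Finset (Fin m)} {j₀ : Fin m} {v : Fin n} (hv : v ∈ priv I M j₀) :
    deg I (M.erase j₀) v = 0 := by
  unfold deg
  rw [card_eq_zero, filter_eq_empty_iff]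
  intro j hj
  exact not_mem_of_mem_priv hv (mem_of_mem_erase hj) (ne_of_mem_erase hj)

/-- Exponent of a private variable after erasing `j₀`: `1`. -/
theorem ex_erase_of_mem_priv {I : LocalMap 4 n m} {M : Finset (Fin m)} {j₀ : Fin m} {v : Fin n} (hv : v ∈ priv I M j₀) :
    ex I (M.erase j₀) v = 1 := by
  unfold ex; rw [deg_erase_of_mem_priv hv]; rfl

/-- Exponent of a private variable of `j₀ ∈ M`: `0`. -/
theorem ex_of_mem_priv {I : LocalMap 4 n m} {M : Finset (Fin m)} {j₀ : Fin m} (hj₀ : j₀ ∈ M) {v : Fin n}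
    (hv : v ∈ priv I M j₀) : ex I M v = 0 := by
  have h := ex_erase I hj₀ v
  rw [ex_erase_of_mem_priv hv, if_pos (priv_subset I M j₀ hv)] at h
  linarith

/-! ## The one-constraint peel -/

/-- On a cylinder free on private variables of `j₀`, the other local factors are constant. -/
theorem prod_mu_erase_cyl {I : LocalMap 4 n m} (y : Fin m → Bool) {M : Finset (Fin m)} {j₀ : Fin m}
    {F : Finset (Fin n)} (hF : F ⊆ priv I M j₀) {x β : Fin n → Bool} (hβ : β ∈ cylOff F x) :
    ∏ j ∈ M.erase j₀, mu I y j β = ∏ j ∈ M.erase j₀, mu I y j x := by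
  refine prod_congr rfl fun j hj => mu_congr I y j fun v hv => ?_
  refine mem_cylOff.1 hβ v fun hvF => ?_
  exact not_mem_of_mem_priv (hF hvF) (mem_of_mem_erase hj) (ne_of_mem_erase hj) hv

/-- On a cylinder free on `F`, a reweighting product whose `F`-exponents vanish is constant. -/
theorem prod_zpow_cyl_of_zero (I : LocalMap 4 n m) {M : Finset (Fin m)} {F : Finset (Fin n)}
    (h0 : ∀ v ∈ F, ex I M v = 0) {x β : Fin n → Bool} (hβ : β ∈ cylOff F x) :
    ∏ v, rho (bias I v) (β v) ^ ex I M v = ∏ v ∈ Fᶜ, rho (bias I v) (x v) ^ ex I M v := by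
  rw [← prod_mul_prod_compl F]
  rw [prod_eq_one fun v hv => by rw [h0 v hv, zpow_zero], one_mul]
  exact prod_congr rfl fun v hv => by rw [mem_cylOff.1 hβ v (mem_compl.1 hv)]

/-- On a cylinder free on `F`, a reweighting product whose `F`-exponents are `1` splits off `∏_{v ∈ F} ρ_v(β_v)`. -/
theorem prod_zpow_cyl_of_one (I : LocalMap 4 n m) {M : Finset (Fin m)} {F : Finset (Fin n)}
    (h1 : ∀ v ∈ F, ex I M v = 1) {x β : Fin n → Bool} (hβ : β ∈ cylOff F x) :
    ∏ v, rho (bias I v) (β v) ^ ex I M v =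
      (∏ v ∈ F, rho (bias I v) (β v)) * ∏ v ∈ Fᶜ, rho (bias I v) (x v) ^ ex I M v := by
  rw [← prod_mul_prod_compl F]
  congr 1
  · exact prod_congr rfl fun v hv => by rw [h1 v hv, zpow_one]
  · exact prod_congr rfl fun v hv => by rw [mem_cylOff.1 hβ v (mem_compl.1 hv)]

/-- The exponent shift of `ex_erase`, multiplied out over the complement of `F ⊆ vars j₀`. -/
theorem prod_zpow_erase (I : LocalMap 4 n m) {M : Finset (Fin m)} {j₀ : Fin m} (hj₀ : j₀ ∈ M) (F : Finset (Fin n))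
    (x : Fin n → Bool) :
    ∏ v ∈ Fᶜ, rho (bias I v) (x v) ^ ex I (M.erase j₀) v =
      (∏ v ∈ Fᶜ, rho (bias I v) (x v) ^ ex I M v) * ∏ v ∈ varSet I j₀ \ F, rho (bias I v) (x v) := by
  have h : ∀ v ∈ Fᶜ, rho (bias I v) (x v) ^ ex I (M.erase j₀) v =
      rho (bias I v) (x v) ^ ex I M v * (if v ∈ varSet I j₀ then rho (bias I v) (x v) else 1) := fun v _ => by
    rw [ex_erase I hj₀ v]
    split_ifs with hv
    · rw [zpow_add_one₀ (rho_bias_pos I v _).ne']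
    · rw [add_zero, mul_one]
  rw [prod_congr rfl h, prod_mul_distrib, prod_ite_mem]
  congr 2
  ext v
  simp only [mem_inter, mem_compl, mem_sdiff]
  exact and_comm

/-- **ONE-CONSTRAINT PEEL.**  On a typed pure-`P⋆` instance, if `j₀ ∈ M` has a set `F` of at least two private variables,
then summing the reweighted weight of `M` over the `F`-coordinates gives the same as for `M \ {j₀}`. -/
theorem peel_step {I : LocalMap 4 n m} (hI : I.IsPure xorAndPred) (hT : PstarTyped.Typed I) (y : Fin m → Bool)
    {M : Finset (Fin m)} {j₀ : Fin m} (hj₀ : j₀ ∈ M) {F : Finset (Fin n)} (hF : F ⊆ priv I M j₀) (h2 : 2 ≤ F.card)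
    (x : Fin n → Bool) :
    ∑ β ∈ cylOff F x, W I y M β = ∑ β ∈ cylOff F x, W I y (M.erase j₀) β := by
  have hFv : F ⊆ varSet I j₀ := hF.trans (priv_subset I M j₀)
  set R : ℝ := ∏ j ∈ M.erase j₀, mu I y j x with hR
  set P : ℝ := ∏ v ∈ Fᶜ, rho (bias I v) (x v) ^ ex I M v with hP
  set G : ℝ := ∏ v ∈ varSet I j₀ \ F, rho (bias I v) (x v) with hG
  have hL : ∀ β ∈ cylOff F x, W I y M β = mu I y j₀ β * (R * P) := fun β hβ => by
    unfold W
    rw [← mul_prod_erase M _ hj₀, prod_mu_erase_cyl y hF hβ,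
      prod_zpow_cyl_of_zero I (fun v hv => ex_of_mem_priv hj₀ (hF hv)) hβ]
    ring
  have hR' : ∀ β ∈ cylOff F x, W I y (M.erase j₀) β = (∏ v ∈ F, rho (bias I v) (β v)) * (R * (P * G)) := fun β hβ => by
    unfold W
    rw [prod_mu_erase_cyl y hF hβ, prod_zpow_cyl_of_one I (fun v hv => ex_erase_of_mem_priv (hF hv)) hβ,
      prod_zpow_erase I hj₀ F x]
    ring
  rw [sum_congr rfl hL, sum_congr rfl hR', ← sum_mul, ← sum_mul, sum_cylOff_mu hI hT y j₀ hFv h2 x,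
    sum_cylOff_prod_rho, one_mul, ← hG]
  ring

/-! ## Lifting cylinder identities to closed sets of assignments -/

/-- Cylinders are symmetric. -/
theorem mem_cylOff_comm {F : Finset (Fin n)} {x β : Fin n → Bool} (h : β ∈ cylOff F x) : x ∈ cylOff F β :=
  mem_cylOff.2 fun v hv => (mem_cylOff.1 h v hv).symm

/-- Cylinders are transitive. -/
theorem mem_cylOff_trans {F : Finset (Fin n)} {x β γ : Fin n → Bool} (h₁ : β ∈ cylOff F x) (h₂ : γ ∈ cylOff F β) :
    γ ∈ cylOff F x :=
  mem_cylOff.2 fun v hv => (mem_cylOff.1 h₂ v hv).trans (mem_cylOff.1 h₁ v hv)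

/-- **Double counting**: summing, over a set closed under changing the `F`-coordinates, the `F`-cylinder sums of `f`
counts every point `#cylinder` times. -/
theorem sum_sum_cylOff {F : Finset (Fin n)} {A : Finset (Fin n → Bool)} (hA : ∀ x ∈ A, ∀ β ∈ cylOff F x, β ∈ A)
    (f : (Fin n → Bool) → ℝ) :
    ∑ x ∈ A, ∑ β ∈ cylOff F x, f β = ∑ β ∈ A, ((cylOff F β).card : ℝ) * f β := by
  classical
  have h1 : ∑ x ∈ A, ∑ β ∈ cylOff F x, f β = ∑ x ∈ A, ∑ β ∈ A with β ∈ cylOff F x, f β := by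
    refine sum_congr rfl fun x hx => ?_
    congr 1
    ext β
    simp only [mem_filter]
    exact ⟨fun h => ⟨hA x hx β h, h⟩, fun h => h.2⟩
  rw [h1, sum_comm' (t' := A) (s' := fun β => A.filter fun x => x ∈ cylOff F β)]
  · refine sum_congr rfl fun β hβ => ?_
    rw [sum_const, nsmul_eq_mul]
    congr 2
    congr 1
    ext x
    simp only [mem_filter]
    exact ⟨fun h => h.2, fun h => ⟨hA β hβ x h, h⟩⟩
  · intro x β
    simp only [mem_filter]
    constructor
    · rintro ⟨hx, hβA, hβ⟩; exact ⟨⟨hx, mem_cylOff_comm hβ⟩, hβA⟩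
    · rintro ⟨⟨hx, hxβ⟩, hβA⟩; exact ⟨hx, hβA, mem_cylOff_comm hxβ⟩

/-- All cylinders over `F` have the same size `2^{#F}`. -/
theorem card_cylOff (F : Finset (Fin n)) (x : Fin n → Bool) : (cylOff F x).card = 2 ^ F.card := by
  classical
  rw [cylOff_eq_piFinset, Fintype.card_piFinset]
  rw [← prod_mul_prod_compl F, prod_eq_one (s := Fᶜ) fun v hv => by rw [if_neg (mem_compl.1 hv), card_singleton], mul_one,
    prod_congr rfl fun v hv => by rw [if_pos hv, card_univ, Fintype.card_bool], prod_const]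

/-- **Lifting**: if two functions have equal sums on every `F`-cylinder centred in a set `A` closed under changing the
`F`-coordinates (a union of `F`-cylinders), they have equal sums on `A`. -/
theorem sum_eq_of_cylOff {F : Finset (Fin n)} {A : Finset (Fin n → Bool)} (hA : ∀ x ∈ A, ∀ β ∈ cylOff F x, β ∈ A)
    {f g : (Fin n → Bool) → ℝ}
    (h : ∀ x ∈ A, ∑ β ∈ cylOff F x, f β = ∑ β ∈ cylOff F x, g β) : ∑ x ∈ A, f x = ∑ x ∈ A, g x := by
  have hf := sum_sum_cylOff hA f
  have hg := sum_sum_cylOff hA g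
  rw [sum_congr rfl h, hg] at hf
  have hc : ∀ β, ((cylOff F β).card : ℝ) = (2 : ℝ) ^ F.card := fun β => by rw [card_cylOff]; push_cast; rfl
  simp only [hc, ← mul_sum] at hf
  exact (mul_right_injective₀ (pow_ne_zero _ two_ne_zero) hf).symm

end Summit.PneNP.PneNP.Theorems.PstarSAPeeling
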